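/-
Seat `ym-line-sgb-p1` (gen 3, prover-ym-line-sgb-p1-g3-0), route `SteinGapBootstrap`, item K1 `SteinBlockTransferG`
(stmt-QuantumFields-22998): the crux AS FILED, unconditionally, from the all-`G` cold-box engine now proved in the tree.
-/
import Summits.QuantumFields.YangMills.Theorems.SteinGapBootstrapSteinBlockTransferGOfColdBox
import Summits.QuantumFields.YangMills.Theorems.ColdBoxAllGroupsBoxFloorAllGroups
import Summits.QuantumFields.YangMills.Theorems.ColdBoxAllGroupsBulkAllGroups

/-!
# K1 `SteinBlockTransferG` (stmt-QuantumFields-22998) — PROVED as filed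

`steinBlockTransferG_proof : Theses.SteinGapBootstrap.SteinBlockTransferG`: for every compact simple `G`, every faithful unitary
lattice representation `r` and every `C₀`, the filed conditional transfer law (equipartition (i) + axis symmetry (ii) + exponential
positive-time clustering at rate `m` (iii) ⇒ the probe time-covariance at separation `n` is within `C(1+m⁻¹+n)^K β^(−δ)` of `g_D(n)`).

Proof: the line's landed reduction `SteinBlockTransferG_of_boxBulkAllG` (lead `ym-line-sgb-k1` g0,
`Theorems/SteinGapBootstrapSteinBlockTransferGOfColdBox.lean`: BOX ∧ BULK ⇒ volume-uniform power-law plaquette floor ⇒ any clustering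
rate `m` admitted by a torus-limit state is `≲ β^(−A/2)`, and the free exponents `K, δ` let the factor `(1+m⁻¹+n)^K` absorb the bound)
applied to the two cruxes of route `ColdBoxAllGroups`, now tree theorems: `ColdBoxAllGroups.BoxFloorAllGroups_proof` (cold-box Gaussian
domination, stmt-22254) and `ColdBoxAllGroups.BulkAllGroups_proof` (DLR bulk transfer, stmt-22255) — their statements are verbatim the
hypotheses `hBox` / `hBulk` of the reduction.

HONEST LABEL.  This closes the item AS FILED through the clustering-rate absorption, with NO Stein generator comparison; the
load-bearing, hypothesis-(iii)-free content of the route is the restated crux U `FreeProbeLawG` (stmt-23756), which this file does not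
touch.  The route serves the RECORD-label rung R2ξ-G (`WeakCouplingRates.XiPow`, itself already proved by route `ColdBoxAllGroups`);
nothing here bears on the Yang–Mills mass gap, a continuum limit, or any summit statement.
-/

set_option autoImplicit false

namespace Summit.QuantumFields.YangMills.Theorems.SteinGapBootstrap

/-- **K1 `SteinBlockTransferG` as filed, unconditionally**: the landed reduction `SteinBlockTransferG_of_boxBulkAllG` applied to the
proved all-`G` cruxes `BoxFloorAllGroups_proof` (BOX) and `BulkAllGroups_proof` (BULK) of route `ColdBoxAllGroups`.  Closes
stmt-QuantumFields-22998 via clustering-rate absorption (no Stein content); RECORD-label rung only, not the Yang–Mills mass gap. -/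
theorem steinBlockTransferG_proof : Summit.QuantumFields.YangMills.Theses.SteinGapBootstrap.SteinBlockTransferG :=
  SteinBlockTransferG_of_boxBulkAllG
    Summit.QuantumFields.YangMills.Theorems.ColdBoxAllGroups.BoxFloorAllGroups_proof
    Summit.QuantumFields.YangMills.Theorems.ColdBoxAllGroups.BulkAllGroups_proof

end Summit.QuantumFields.YangMills.Theorems.SteinGapBootstrap
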